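import Mathlib.RingTheory.PowerSeries.Inverse
import Mathlib.Data.Complex.Basic
import HarnessLib

/-!
# Truncated uniqueness of cube roots in `R⟦X⟧` (ENGINE E2, the «cube upgrade» of MEMO-an §104)

Cell `bsd-f2-manin`, route `ManinLocalTwoThree`, crux C2/C3; an g59.  If two power series `g, c` over a field with `3 ≠ 0` both start
`X + O(X²)` and their cubes agree modulo `X^{K+3}`, then `g ≡ c (mod X^{K+1})` — because
`g³ − c³ = X³·(g₁ − c₁)·(g₁² + g₁c₁ + c₁²)` with `g = Xg₁`, `c = Xc₁`, and the last factor has constant term `3`, a unit.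
USE (§104, E2): `g = qExpansion 1 f₀` (`f₀ ∈ S₂(Γ₀(57))` a root form with `a₀ = 0`, `a₁ = 1`, table certified to `41` directly), `g³ = qExpansion` of
`f₀³ ∈ M₆(Γ₀(57))` identified with an `η`-combination `F₃` by Sturm (`40 < 41`), whose table is certified to `190`; `c` = the claimed integer table
`cF` of `f₀` to `190` with `cF³ ≡ table(F₃) (mod X¹⁹⁰)` checked by `decide`; conclusion: `aₙ(f₀) = cF[n]` for `n < 188` — the depth `187` the weight-6
root squeezes at level `57` need, from seed tables of depth `3·41 = 123` instead of `3·187 = 561`.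
HONEST FRAMING: elementary algebra; standard axioms; nothing here proves C2/C3, Manin's conjecture or BSD.  [folklore]
-/

set_option autoImplicit false
-- lint-debt: the directory name repeats the summit name (sibling precedent `ManinLocalTwoThreeAlgIntCubeRoot.lean`)
set_option linter.dupNamespace false

noncomputable section

open PowerSeries

namespace Summit.BirchSwinnertonDyer.BirchSwinnertonDyer.Theorems.ManinLocalTwoThree.CubeRootUnique

variable {R : Type*} [Field R]

/-- `g³ − c³ = X³·((g₁ − c₁)(g₁² + g₁c₁ + c₁²))` for `g = Xg₁`, `c = Xc₁`. [folklore] -/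
theorem cube_sub_cube_factor (g₁ c₁ : R⟦X⟧) :
    (X * g₁) ^ 3 - (X * c₁) ^ 3 = X ^ 3 * ((g₁ - c₁) * (g₁ ^ 2 + g₁ * c₁ + c₁ ^ 2)) := by
  ring

/-- `g₁² + g₁c₁ + c₁²` is a unit when `g₁(0) = c₁(0) = 1` and `3 ≠ 0`. [folklore] -/
theorem isUnit_quad (h3 : (3 : R) ≠ 0) {g₁ c₁ : R⟦X⟧} (hg : constantCoeff g₁ = 1) (hc : constantCoeff c₁ = 1) :
    IsUnit (g₁ ^ 2 + g₁ * c₁ + c₁ ^ 2) := by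
  rw [isUnit_iff_constantCoeff]
  have h : constantCoeff (g₁ ^ 2 + g₁ * c₁ + c₁ ^ 2) = 3 := by
    simp only [map_add, map_mul, map_pow, hg, hc]
    norm_num
  rw [h]
  exact isUnit_iff_ne_zero.mpr h3

/-- **Truncated uniqueness of cube roots**: `X^{K+3} ∣ g³ − c³`, `g ≡ c ≡ X (mod X²)` ⇒ `X^{K+1} ∣ g − c` (`3 ≠ 0` in `R`). [folklore] -/
theorem X_pow_dvd_sub_of_cube (h3 : (3 : R) ≠ 0) {g c : R⟦X⟧} {K : ℕ}
    (h : X ^ (K + 3) ∣ g ^ 3 - c ^ 3) (hg0 : constantCoeff g = 0) (hc0 : constantCoeff c = 0)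
    (hg1 : coeff 1 g = 1) (hc1 : coeff 1 c = 1) : X ^ (K + 1) ∣ g - c := by
  obtain ⟨g₁, rfl⟩ := X_dvd_iff.mpr hg0
  obtain ⟨c₁, rfl⟩ := X_dvd_iff.mpr hc0
  have hg1' : constantCoeff g₁ = 1 := by
    rw [← coeff_zero_eq_constantCoeff_apply, ← coeff_succ_X_mul 0 g₁]; exact hg1
  have hc1' : constantCoeff c₁ = 1 := by
    rw [← coeff_zero_eq_constantCoeff_apply, ← coeff_succ_X_mul 0 c₁]; exact hc1
  rw [cube_sub_cube_factor, pow_add, mul_comm (X ^ K) (X ^ 3)] at h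
  have h' : X ^ K ∣ (g₁ - c₁) * (g₁ ^ 2 + g₁ * c₁ + c₁ ^ 2) :=
    (mul_dvd_mul_iff_left (pow_ne_zero 3 X_ne_zero)).mp h
  have h'' : X ^ K ∣ g₁ - c₁ := (isUnit_quad h3 hg1' hc1').dvd_mul_right.mp h'
  rw [show X * g₁ - X * c₁ = X * (g₁ - c₁) by ring, pow_succ']
  exact mul_dvd_mul_left X h''

/-- **Coefficient form**: if `aₘ(g³) = aₘ(c³)` for `m < K + 3` and `g ≡ c ≡ X (mod X²)`, then `aₙ(g) = aₙ(c)` for `n < K + 1`. [folklore] -/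
theorem coeff_eq_of_coeff_cube_eq (h3 : (3 : R) ≠ 0) {g c : R⟦X⟧} {K : ℕ}
    (h : ∀ m < K + 3, coeff m (g ^ 3) = coeff m (c ^ 3)) (hg0 : constantCoeff g = 0) (hc0 : constantCoeff c = 0)
    (hg1 : coeff 1 g = 1) (hc1 : coeff 1 c = 1) : ∀ n < K + 1, coeff n g = coeff n c := by
  have hd : X ^ (K + 3) ∣ g ^ 3 - c ^ 3 := X_pow_dvd_iff.mpr fun m hm ↦ by rw [map_sub, h m hm, sub_self]
  have := X_pow_dvd_iff.mp (X_pow_dvd_sub_of_cube h3 hd hg0 hc0 hg1 hc1)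
  intro n hn
  exact sub_eq_zero.mp (by rw [← map_sub]; exact this n hn)

/-- **Table form over `ℂ`** (the shape the level-`57` root files use): `g = qExpansion 1 f₀` with `a₀ = 0`, `a₁ = 1`; `Φ` = the cube's expansion
(`= qExpansion 1 F₃`); an integer list `cF` with `cF[0] = 0`, `cF[1] = 1` whose cube matches `Φ` to depth `K + 3` (a decidable check once `Φ`'s
table is certified); then `aₙ(g) = cF[n]` for `n < K + 1`. [folklore] -/
theorem coeff_eq_table_of_cube {g Φ : ℂ⟦X⟧} {K : ℕ} (cF : List ℤ) (hcube : ∀ m < K + 3, coeff m (g ^ 3) = coeff m Φ)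
    (hcF : ∀ m < K + 3, coeff m ((PowerSeries.mk fun n ↦ ((cF.getD n 0 : ℤ) : ℂ)) ^ 3) = coeff m Φ)
    (hg0 : constantCoeff g = 0) (hg1 : coeff 1 g = 1) (h0 : cF.getD 0 0 = 0) (h1 : cF.getD 1 0 = 1) :
    ∀ n < K + 1, coeff n g = ((cF.getD n 0 : ℤ) : ℂ) := by
  have hc0 : constantCoeff (PowerSeries.mk fun n ↦ ((cF.getD n 0 : ℤ) : ℂ)) = 0 := by
    rw [← coeff_zero_eq_constantCoeff_apply, coeff_mk, h0]; simp
  have hc1 : coeff 1 (PowerSeries.mk fun n ↦ ((cF.getD n 0 : ℤ) : ℂ)) = 1 := by rw [coeff_mk, h1]; simp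
  intro n hn
  rw [coeff_eq_of_coeff_cube_eq (by norm_num) (fun m hm ↦ by rw [hcube m hm, hcF m hm]) hg0 hc0 hg1 hc1 n hn, coeff_mk]

/-- Sanity instance: `(X + X²)³` vs `X + X²` itself — the hypotheses are consistent (`K = 0`). [folklore] -/
example : ∀ n < 0 + 1, coeff n ((X : ℚ⟦X⟧) + X ^ 2) = coeff n ((X : ℚ⟦X⟧) + X ^ 2) :=
  coeff_eq_of_coeff_cube_eq (by norm_num) (fun _ _ ↦ rfl) (by simp) (by simp) (by simp [coeff_X_pow]) (by simp [coeff_X_pow])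

end Summit.BirchSwinnertonDyer.BirchSwinnertonDyer.Theorems.ManinLocalTwoThree.CubeRootUnique

end
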